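import Summits.PneNP.PneNP.Theses.PhaseTwins
import Summits.PneNP.PneNP.Theorems.PhaseTwinsMacroscopicTwinsAboveDefs
import Summits.PneNP.PneNP.Theorems.PhaseTwinsMacroscopicTwinsAboveMaxDegree
import Summits.PneNP.PneNP.Theorems.PhaseTwinsPolyDepthTwinsAboveChargeVisible
import Literature.Computability.Complexity.HardcoreInapproximability
import Literature.ModelTheory.FiniteModelTheory.CFIMatchingGraphs
import Literature.ModelTheory.FiniteModelTheory.CkEquivHomCount
import Literature.ModelTheory.FiniteModelTheory.CkEquivTransfer
import Literature.ModelTheory.FiniteModelTheory.XorLocalConsistency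

/-!
# Line `literal-gadgets-cfi-apparatus` for crux `PhaseTwins.MacroscopicTwinsAbove` (stmt-PneNP-2720)

Skeleton (crux-plan, planner-cruxplan-stmt-PneNP-2720-literal-gadgets-cfi--0, 2026-08-16) of the crux idea
`literal-gadgets-cfi-apparatus` (crux-ideate r1, ideator 1; triage r1-1/r1-2/r1-3: pass ×3, merge with
`hypergraph-tseitin-fixed-gadget`; component `girth-twins` as the base-system supplier), with the triage
sharpenings built in: (a) the anti-alignment unit is TWO-SIDED (`κ₁` `V⁺–V⁺` AND `κ₁` `V⁻–V⁻` pair edges, same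
slot on both literal gadgets; `pairW` of the sibling definitions file), (b) both twins live on ONE vertex type
(inner vertices indexed by two free bits `S' : Fin 2 → ZMod 2`, the third bit fixed by the charge through
`CFIMatching.bit`), so `ckEquiv_of_consistencyFamily` applies verbatim, (c) the sector inequality
`K·D·log R ≤ κ₁·log B` (where bounded occurrence `D` enters) is an explicit hypothesis of the energy stub and an
explicit conclusion of the parameter stub, (d) the copy-explicit sandwich (Lemma B) is its own stub with NO
restriction `#copies ≤ n^{θ/4}` — the error is `(1 ± δ)^{2·nv}` for EVERY number `nv` of variables.

THE LINE. Fix `Δ ≥ 3`, `λ > λ_c(Δ)`. ONE Sly phase gadget `(G, W±, V±)` of ONE size `n = n(Δ, λ)` (stub S1 =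
the derandomised Sly 2010 Thm 2.1, the declared trust base shared with the sibling line `parity-wired-ports` of
crux 2719 — identical statement) gives `d ≤ Δ`, `0 < q⁻ < q⁺ < 1`, `(GpropA)` at `n`, `(GpropB)` with
`δ₁ = n^{-2θ} ≤ 1/2`, and `P = slyM d θ n` ports per side. For every `k`, stub S2 (`girth-twins`: (6,3)-biregular
incidence graphs of girth `> 12(k+1)`, Füredi–Lazebnik–Seress–Ustimenko–Woldar 1995; or pruned Atserias–Dawar
systems) supplies a 3-XOR system `E : Fin m → Fin 3 → Fin nv` (three distinct variables per equation, occurrences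
properly `D`-coloured by `loc`, `nv ≤ m ≤ c·nv`) that is a `(6(k+1), 1)`-boundary expander, together with a
right-hand side `b` that is `t`-FAR (`t ≥ η m`): EVERY assignment violates `≥ t` equations. The twins are
`𝔊₀ = lgGraph E loc W 0` and `𝔊_b = lgGraph E loc W b` on the uniform vertex type `LGVert nv m v K`:
* one gadget copy `g_{x,a}` per LITERAL `(x, a) ∈ Fin nv × ZMod 2` (copy vertices `(x, a, y)`), the two literal
  gadgets of `x` ANTI-ALIGNED by `κ₁` pair edges `V⁺(slot j)—V⁺(slot j)` and `κ₁` pair edges `V⁻(slot j)—V⁻(slot j)`;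
* per equation `e` and copy index `j < K`, the ten-vertex Cai–Fürer–Immerman parity complex of charge `b e`
  (inner vertices `(e, j, S')`, end vertices `(e, j, i, a)`, inner–end adjacency `bit (b e) S' i = a`), whose end
  `(e, j, i, a)` is plugged into the `V⁺` port in slot `(loc (e, i), j)` of the literal gadget `g_{E e i, a}`.
DUPLICATOR (S3): flipping by `f : Fin nv → ZMod 2` — `(x,a,y) ↦ (x, a + f x, y)`, `(e,j,i,a) ↦ (e,j,i,a + f(E e i))`,
`(e,j,S') ↦ (e,j,S' + f∘E e∘castSucc)` — is a graph isomorphism `𝔊_b ≅ 𝔊_{b + ∂f}` that permutes literal gadgets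
as blocks and never renames a port (so the sibling NO-GO "name-reserved ports are 1-WL-separable", kit j005776,
does not apply); with data `{x}` / `{E e i}` / `scope e` (`≤ 3` variables per vertex) and the consistency family
`XorSystem.Good (lgScope E) b (6(k+1))` of the far system (`isConsistencyFamily_good`, p = q = 1), the
compatibility clause of `ckEquiv_of_consistencyFamily` is `∂f(e) = b e` on pebbled scopes = `Good.sum_scope_eq`;
hence `𝔊₀ ≡_{C^{k+1}} 𝔊_b`. ENERGY (S5 + S6): by `(GpropB)` the ports are `(1 ± δ₁)`-product-Bernoulli given
the phase vector `Y : Fin nv × ZMod 2 → Bool`, so `Z_{𝔊_b}(Y) ∈ (1 ± δ₁)^{2nv} · lgW b Y · Z_base(Y)` with the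
EXPLICIT weight `lgW b Y = Π_x pairW(Y(x,0), Y(x,1)) · Π_e cxW(b e; phases of the six literal gadgets of e)^K`
(S5, copy-explicit Sly Lemma 2.2 — the line's Lemma B; `(phaseProbs)` `Z_base(Y) ≥ n^{-2nv} Z_base` from
`(GpropA)`); the contrast identity `F₀ − F₁ = λ⁴(q⁺−q⁻)³/(1+λ)^{10} > 0` (S6(i), = the sibling's
`stub_chargeVisible`, kit j007440/j009414/j009588, re-derived by all three triagers) and the sector inequality
give `lgW b Y · ρ^{K t} ≤ lgW 0 Y_ref` for EVERY `Y` (S6(ii): anti-aligned `Y` read an assignment `h`, the complex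
at `e` weighs `F_{b e + Σ_i h(E e i)}` by Tseitin covariance, and `≥ t` equations are violated; an aligned
variable loses `B^{κ₁}` and perturbs `≤ D` equations by `≤ R^{K}` each). PARAMETERS (S7): `n, K, κ₁` with
`κ₁ + DK ≤ P`, `KD log R ≤ κ₁ log B`, `n^{-2θ} ≤ 1/2`, `1 + 2 log(3n) ≤ K η g` exist (`P ≥ n^θ/(d−1) ≫ log n`).
Then (`twins_of_estimates` + `budget`, PROVED here) `e^{δ N} Z(𝔊_b) ≤ Z(𝔊₀)` with `N = 2·nv·v + 10·m·K` and
`δ = 1/(2v + 10cK + 1)` — a constant of `(Δ, λ)` fixed BEFORE `k`. Degrees (S4): ports `≤ (d−1)+1`, ends `1+2`,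
inner `3`, so `≤ Δ` (Δ = 3 included: λ > 4 forces d = 3). The composition `MacroscopicTwinsAbove_of` transports to
`Fin N` (`CkEquiv.iso_congr`, `Iso.maxDegree_eq`, `independencePolynomial_map_equiv`) and converts `≡_{C^{k+1}}`
into the typed hom-count clause by the PROVED Dvořák bridge `Dvorak2010.homCount_eq_of_ckEquiv`.

Stubs (7): `stub_slyGadgets` (XL; trust base = hypothesis `h21` of `slyGadgetReduction_of_gadgets`, identical to
the sibling line's S1 — NOT a lead-prover target), `stub_farSystems` (M; girth-twins Lemmas D + E + FLSUW95, or
AD19 + pruning), `stub_duplicator` (M; one instance of `ckEquiv_of_consistencyFamily`), `stub_maxDegree` (S–M),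
`stub_connector` (L; HARDEST provable-now: Sly's Lemma 2.2 for this wiring with copy-explicit error),
`stub_energy` (M; (i) contrast identity = sibling `stub_chargeVisible` verbatim, (ii) the sector optimisation),
`stub_parameters` (M; asymptotic arithmetic `log n = o(slyM d θ n)`).

Disproof.lean (cdisprove cycle 1, verdict NOT refuted) honoured: `false_without_threshold_of_densityContinuityBelow`
— the threshold is used exactly once, in S1 (`q⁻ < q⁺` exists only for `λ > λ_c(d)`), and read exactly once, in
S6(i) (`g > 0`); `false_without_degreeFloor` — `3 ≤ Δ` enters S1 and S4; `withoutPosN_trivial` — `N ≥ 10mK ≥ 10`;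
TIGHTNESS `defect_bound`/`defect_bound_perm`/`delta_le_of_blocks` (LANDED as
`Theorems/MacroscopicTwinsAbove/Negative/DefectBound.lean`, imported below so the skeleton is checked against it):
the twins differ, under every gauge `f`, on the inner–end edges of the `K·wt(b + ∂f) ≥ K·t = Θ(N)` charged
complexes — a positive FRACTION of the vertices, as the bound demands (bare CFI / one Tseitin charge / disjoint
unions are NOT used); `lt_card_of_witness`/`not_singlePair` — a fresh system per `k`, `δ` fixed first;
`swapped_of_constantFactorTwins` — not relied on. Negatives index (PneNP: 0265, 0988, 10247, 2493, 2222): unrelated.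
-/

noncomputable section

open scoped Classical BigOperators

namespace Summit.PneNP.PneNP.Cruxes.MacroscopicTwinsAbove.LiteralGadgetsCfiApparatus

open Finset
open Literature.Computability.Complexity (hardcoreZOn slyPhase SlyPropA SlyPropB slyB slyM
  slyGadgetReduction one_lt_slyB sum_hardcoreZOn_fiber le_and_le_of_abs_sub_le hardcoreZOn_nonneg
  hardcoreZOn_le_independencePolynomial)
open Literature.ModelTheory.FiniteModelTheory (CkEquiv IsConsistencyFamily IsLocalFlipAction
  ckEquiv_of_consistencyFamily)
open Literature.ModelTheory.FiniteModelTheory.CFIMatching (bit)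
open Literature.Probability.LatticeModels (independencePolynomial hardCoreThreshold hardCoreThreshold_pos
  independencePolynomial_pos)
open Literature.Combinatorics.SimpleGraph (treewidth)
open Summit.PneNP.PneNP.Theses.PhaseTwins (MacroscopicTwinsAbove)
open Summit.PneNP.PneNP.Cruxes.PolyDepthTwinsAbove.ParityWiredPorts (occP occM pairW CxVert cxGraph cxWeight
  cxW pwPsi cxRho stub_chargeVisible)

set_option linter.unusedVariables false
set_option linter.dupNamespace false

variable {nv m v P κ₁ D K : ℕ}

/-! ## The stubs -/

/-- **S1 — Sly's phase gadgets = Sly 2010 Theorem 2.1, derandomised (GŠV16 Lemma 19; GGŠVY Lemma 5 / Cor. 6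
for the degree covering).** Literally the hypothesis `h21` of the tree's `slyGadgetReduction_of_gadgets`, hence
EQUIVALENT to the named fact `slyGadgetReduction`, and VERBATIM the statement of `stub_slyGadgets` of the
sibling line `parity-wired-ports` (crux 2719) — one proof serves both lines. For `Δ ≥ 3`, `λ > λ_c(Δ)`: `d ∈ [3, Δ]`
with `λ > λ_c(d)`, `θ ∈ (0, 1/8)`, `0 < q⁻ < q⁺ < 1` and, for all large `n`, a gadget on `≤ 3n` vertices of
maximum degree `≤ d`, `2·slyM d θ n` distinct ports of degree `≤ d − 1`, `(GpropA)` at `n`, `(GpropB)` with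
`δ = n^{-2θ}`. THIS line uses it at ONE size `n = n(Δ, λ)` only (no `SlyCutEstimate`, no `N ≤ n^{θ/4}`). The
declared trust base of every Sly-based line on cruxes 2719/2720 (triage: common ceiling); size XL; NOT a
lead-prover target (tree programme `HardcoreInapproximabilityProofs`). -/
theorem stub_slyGadgets : ∀ Δ : ℕ, 3 ≤ Δ → ∀ lam : ℝ, hardCoreThreshold Δ < lam →
    ∃ d : ℕ, 3 ≤ d ∧ d ≤ Δ ∧ hardCoreThreshold d < lam ∧
    ∃ θ qp qm : ℝ, 0 < θ ∧ θ < 1 / 8 ∧ 0 < qm ∧ qm < qp ∧ qp < 1 ∧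
      ∃ n₁ : ℕ, ∀ n : ℕ, n₁ ≤ n →
        ∃ (v : ℕ) (G : SimpleGraph (Fin v)) (Wp Wm : Finset (Fin v))
          (Vp Vm : Fin (slyM d θ n) ↪ Fin v),
          (v : ℝ) ≤ 3 * n ∧ G.maxDegree ≤ d ∧ Disjoint Wp Wm ∧
            Disjoint (Set.range Vp) (Set.range Vm) ∧
            (∀ i, G.degree (Vp i) ≤ d - 1) ∧ (∀ i, G.degree (Vm i) ≤ d - 1) ∧
            SlyPropA G lam Wp Wm n ∧
            SlyPropB G lam Wp Wm Vp Vm qp qm ((n : ℝ) ^ (-(2 * θ))) := by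
  sorry

/-- S1 is exactly what the named fact `slyGadgetReduction` provides (sanity link, PROVED). -/
example (h : slyGadgetReduction) : ∀ Δ : ℕ, 3 ≤ Δ → ∀ lam : ℝ, hardCoreThreshold Δ < lam →
    ∃ d : ℕ, 3 ≤ d ∧ d ≤ Δ ∧ hardCoreThreshold d < lam ∧
    ∃ θ qp qm : ℝ, 0 < θ ∧ θ < 1 / 8 ∧ 0 < qm ∧ qm < qp ∧ qp < 1 ∧
      ∃ n₁ : ℕ, ∀ n : ℕ, n₁ ≤ n →
        ∃ (v : ℕ) (G : SimpleGraph (Fin v)) (Wp Wm : Finset (Fin v))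
          (Vp Vm : Fin (slyM d θ n) ↪ Fin v),
          (v : ℝ) ≤ 3 * n ∧ G.maxDegree ≤ d ∧ Disjoint Wp Wm ∧
            Disjoint (Set.range Vp) (Set.range Vm) ∧
            (∀ i, G.degree (Vp i) ≤ d - 1) ∧ (∀ i, G.degree (Vm i) ≤ d - 1) ∧
            SlyPropA G lam Wp Wm n ∧
            SlyPropB G lam Wp Wm Vp Vm qp qm ((n : ℝ) ^ (-(2 * θ))) := by
  intro Δ hΔ lam hlam
  obtain ⟨d, hd3, hdΔ, hdlam, θ, qp, qm, hθ, hθ8, hqm, hlt, hqp, hmain⟩ := h Δ hΔ lam hlam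
  obtain ⟨n₁, hn₁⟩ := hmain (1 / 2) (by norm_num)
  refine ⟨d, hd3, hdΔ, hdlam, θ, qp, qm, hθ, hθ8, hqm, hlt, hqp, n₁, fun n hn => ?_⟩
  obtain ⟨v, G, Wp, Wm, Vp, Vm, hv, hdeg, hW, hVV, hdp, hdm, hA, hB, -⟩ := hn₁ n hn
  exact ⟨v, G, Wp, Wm, Vp, Vm, hv, hdeg, hW, hVV, hdp, hdm, hA, hB⟩

/-- **S2 — far-from-satisfiable, locally consistent, bounded-occurrence 3-XOR systems for every radius `s`
(RESHAPED by the lead, 2026-08-16: `(s, 1/2)`-boundary expansion `|T| ≤ 2|∂T|` instead of `(6k, 1)`; the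
composition instantiates `stub_duplicator` with `p = 2, q = 1, s = 12(k+1), K₀ = 3(k+1)`).** There are constants
`D` (occurrence colours), `c` (`m ≤ c·nv`) and `η > 0` such that for every `s` there is a system of `m` equations
`x_{E e 0} + x_{E e 1} + x_{E e 2} = b e` on `nv ≥ 1` variables with three DISTINCT variables per equation,
`nv ≤ m ≤ c·nv`, a labelling `loc` of the occurrences that is injective on the occurrences of each variable (so
occurrence `≤ D`), `(s, 1/2)`-BOUNDARY EXPANSION (`|T| ≤ 2|∂T|` for `|T| ≤ s`, the hypothesis shape of
`XorSystem.good_empty/good_extend` with `p = 2, q = 1`), and a right-hand side `b` that is `t`-FAR with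
`t ≥ η m`: every total assignment violates at least `t` equations. Why true: ALL ingredients are PROVED in the
tree — exactly the first half of `SparseOrData.exists_data` (`Literature/ModelTheory/FiniteModelTheory/
SparseOrData.lean`): `Xor3Gap.exists_threeUniformExpander` (`192τ` variables, `m = 768τ` scopes of size 3,
`7|T| ≤ 4|N(T)|` for `|T| ≤ 192τ/1728⁴`, so `τ := max s 1 · 1728⁴`), `SparseOrData.splitScope F 48` (occurrence
`≤ 48 =: D` by `splitDeg_le`, expansion kept by `card_biUnion_le_card_biUnion_split`, `192τ ≤ nv ≤ 240τ` by
`le_card_splitVar`/`card_splitVar_le`, so `nv ≤ m ≤ 4 nv`, `c = 4`), `Xor3Gap.card_le_two_mul_card_boundary`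
(`|T| ≤ 2|∂T|`), `SparseOrData.exists_far` with `far_ineq` (`p = 2`: every assignment violates `≥ 48τ + 1 ≥ m/16`
equations, `η = 1/16`); then order each 3-element scope (`Finset.orderEmbOfFin`/`card_eq_three`) to get
`E e : Fin 3 → Fin nv` injective with `lgScope E e =` the scope, transport `SplitVar ≃ Fin nv`
(`Fintype.equivFin`), and `loc (e, i) := SparseOrData.rank` of `e` among the scopes containing `E e i` (`< 48`,
injective on the occurrences of a variable by `rank_injOn`). Size M (assembly + reindexing). The girth supplier of
the card (`girth-twins` Lemmas D/E + FLSUW95) remains an alternative for the same signature. -/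
theorem stub_farSystems : ∃ (D c : ℕ) (η : ℝ), 0 < η ∧ ∀ s : ℕ,
    ∃ (nv m t : ℕ) (E : Fin m → Fin 3 → Fin nv) (loc : Fin m × Fin 3 → Fin D) (b : Fin m → ZMod 2),
      0 < nv ∧ nv ≤ m ∧ m ≤ c * nv ∧ (∀ e, Function.Injective (E e)) ∧
      (∀ p p' : Fin m × Fin 3, E p.1 p.2 = E p'.1 p'.2 → loc p = loc p' → p = p') ∧
      (∀ T : Finset (Fin m), T.card ≤ s →
        T.card ≤ 2 * (Literature.ModelTheory.FiniteModelTheory.XorSystem.boundary (lgScope E) T).card) ∧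
      η * m ≤ t ∧
      ∀ f : Fin nv → ZMod 2, t ≤ (Finset.univ.filter fun e : Fin m => ∑ i : Fin 3, f (E e i) ≠ b e).card := by
  sorry

/-- **S3 — Duplicator (Lemma A of the card: CFI gauge + local consistency; Atserias–Dawar 2019 Lemma 3.2 in
the abstract form `ckEquiv_of_consistencyFamily`).** On an `(s, q/p)`-boundary expander with `2pK₀ ≤ qs` and
`3k ≤ K₀`, the literal-gadget graphs of ANY right-hand side `b` and of `0` are `≡_{C^k}` — for every gadget,
wiring and occurrence labelling. Why true: the flip `lgFlipFun E f` (an involution) is an isomorphism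
`lgGraph E loc W b ≅ lgGraph E loc W (b + ∂f)`, `(∂f) e = Σ_i f (E e i)`: pair edges join `(x,a,y)`, `(x,a+1,y)`
(invariant), end–copy edges use the slot `(loc(e,i), j)` on both sides and shift `a` by the same `f (E e i)`,
inner–end adjacency `bit (b e) S' i = a` becomes `bit (b e + ∂f e) (S' + f∘E e∘castSucc) i = a + f (E e i)`
(`CFIMatching.bit_shift` pattern; `E e` injective); so with data `lgData E` (`|D x| ≤ c₀ = 3`, `card_lgData_le`),
`isLocalFlipAction_lgFlip` (PROVED above), the consistency family `XorSystem.Good (lgScope E) b s` with bound `K₀`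
(`isConsistencyFamily_good hq hexp hK₀`) and the compatibility clause reduced to `∂f e = b e` whenever
`lgScope E e ⊆ dom` (`XorSystem.Good.sum_scope_eq`, `hs`), `ckEquiv_of_consistencyFamily` gives the claim.
Size M (the `CountingWidthXorHam.ckEquiv_padGraph` pattern, ~150 lines). -/
theorem stub_duplicator (E : Fin m → Fin 3 → Fin nv) (hE : ∀ e, Function.Injective (E e))
    (loc : Fin m × Fin 3 → Fin D) (W : LWiring v P κ₁ D K) (b : Fin m → ZMod 2) {s p q K₀ k : ℕ}
    (hs : 1 ≤ s) (hq : 0 < q)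
    (hexp : ∀ T : Finset (Fin m), T.card ≤ s →
      q * T.card ≤ p * (Literature.ModelTheory.FiniteModelTheory.XorSystem.boundary (lgScope E) T).card)
    (hK₀ : 2 * p * K₀ ≤ q * s) (hk : 3 * k ≤ K₀) :
    CkEquiv k (lgGraph E loc W 0) (lgGraph E loc W b) := by
  sorry

-- S4 `stub_maxDegree`: LANDED (p77122) as `Theorems/PhaseTwinsMacroscopicTwinsAboveMaxDegree.lean`, imported above.

/-- **S5 — the copy-explicit connector sandwich (Lemma B of the card; Sly's Lemma 2.2 for the literal-gadget
wiring; HARDEST provable-now stub).** For ANY gadget with `(GpropA)` at `n ≥ 1` and `(GpropB)` with error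
`δ ∈ [0, 1]`, any system, right-hand side and occurrence labelling injective on the occurrences of each variable,
`LGCutEstimate` holds: `(phaseProbs)` because on `lgBase` the `2nv` literal gadgets are independent and the
`10mK` complex vertices isolated, `Z_base(Y) = Π_g Z_G(Y_g)·(1+λ)^{10mK} ≥ (Z_G/n)^{2nv}(1+λ)^{10mK}`
(`phaseProbs_of_slyPropA` pattern); `(cutProb)` because, grouping the independent sets of `lgGraph` with phase
vector `Y` by the family of port configurations of the copies, `Z_{𝔊}(Y) = Σ_{(S_g)} [Π_g Z_G(Y_g ∧ σ_V = S_g)]·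
Wt((S_g))` with `Wt ≥ 0` (pair-edge indicators times, per complex, `Σ_{J indep} λ^{|J|} Π_{ends ∈ J}[port
vacant]`), `(GpropB)` bounds each bracket termwise by `(1±δ)^{2nv} Π_g Q^{Y_g}(S_g) Z_G(Y_g)`
(`cutProb_bounds_of_slyPropB` pattern — POINTWISE ratio form, so valid for every `nv`), and under the product
measure the expectation FACTORISES over variables and complexes because they use pairwise distinct ports
(`slot` injective, `Vp`/`Vm` disjoint embeddings, `hloc`): `E[Wt] = Π_x pairW · Π_e (cxWeight)^K`
(`sum_bernoulliWeight_noPair`, `sum_bernoulliWeight_superset`), i.e. `lgW b Y · (1+λ)^{10mK}`. Size L (adapt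
`hardcoreZOn_gadgetSubst_phaseVec_eq_sum`, `sum_patterns_portLaw`, `cutProb_bounds_of_slyPropB`; triage r1-3:
state it once for a generic connector family if convenient — pairs and complexes are then instances). -/
theorem stub_connector (E : Fin m → Fin 3 → Fin nv) (loc : Fin m × Fin 3 → Fin D)
    (hloc : ∀ p p' : Fin m × Fin 3, E p.1 p.2 = E p'.1 p'.2 → loc p = loc p' → p = p')
    (W : LWiring v P κ₁ D K) {lam qp qm δ : ℝ} (hlam : 0 ≤ lam) (hqm : 0 < qm) (hlt : qm < qp)
    (hqp : qp < 1) (hδ0 : 0 ≤ δ) (hδ1 : δ ≤ 1) {n : ℕ} (hn : 0 < n)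
    (hVV : Disjoint (Set.range W.Vp) (Set.range W.Vm))
    (hA : SlyPropA W.G lam W.Wp W.Wm n) (hB : SlyPropB W.G lam W.Wp W.Wm W.Vp W.Vm qp qm δ)
    (b : Fin m → ZMod 2) : LGCutEstimate E loc W lam qp qm δ n b := by
  sorry

/-- **S6 — the sector optimisation of the weights (RESHAPED by the lead, 2026-08-16: part (i), charge
visibility `Ψ(1) < Ψ(0)`, IS the sibling line's LANDED `ParityWiredPorts.stub_chargeVisible`
(`Theorems/PhaseTwinsPolyDepthTwinsAboveChargeVisible.lean`) and is imported by the composition; this stub is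
part (ii) only).** For `λ > 0`, `0 < q⁻ < q⁺ < 1`: if every variable occurs in `≤ D` equations, every
assignment violates `≥ t` equations of `(E, b)`, and the pair coupling dominates (`K·D·log ρ_F ≤ κ₁·log B`,
`ρ_F = cxRho`, `B = slyB`), then EVERY phase vector `Y` of the `b`-twin weighs at most `e^{−K t (Ψ0−Ψ1)}` times
the reference vector of the `0`-twin: `lgW b Y · e^{K t (Ψ0 − Ψ1)} ≤ lgW 0 lgRef`. Why true: write `A` for the set
of ALIGNED variables (`Y(x,0) = Y(x,1)`) and `h x := [Y(x,0) = −]` off `A` (anything on `A`); pair factors: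
anti-aligned `pairW(+,−) = pairW(−,+) = (1−q⁺q⁻)^{2κ₁}`, aligned `pairW(±,±) = pairW(+,−) · B^{−κ₁}`; so
`lgW b Y / lgW 0 ref = B^{−κ₁|A|} Π_e (F_e(Y)/F₀)^K` with `F₀ = e^{Ψ0} = cxW 0 ref`. An equation `e` untouched
by `A` has factor `F_e(Y) = cxW (b e) (ref ∘ shift h) = F_{b e + Σ_i h(E e i)}` (Tseitin covariance of the complex:
`(i,a) ↦ (i, a + g i)`, `S' ↦ S' + g|` maps `cxGraph c ≅ cxGraph (c + Σ g)`, the `bit_shift` identity; on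
weights `cxW c (y ∘ shift g) = cxW (c + Σ g) y`), i.e. `F₀` if `h` satisfies `e` and `F₁ = e^{Ψ1}` otherwise; a
touched equation has `F_e(Y) ≤ F_max := cxW · (all phases −)` (monotonicity of `cxWeight` in the vacancies
`1 − occP`, nonnegative coefficients) and `F₁ ≥ F_min := cxW · (all phases +)`, the two constant-phase values
being charge-independent (covariance again), `F_max/F_min = cxRho =: R`. Of the `≥ t` equations violated by `h`
at most `#touched ≤ D|A|` are touched, so
`ratio ≤ B^{−κ₁|A|} (F_max/F₀)^{K·#touched} (F₁/F₀)^{K(t − #touched)} = (F₁/F₀)^{Kt} B^{−κ₁|A|} (F_max/F₁)^{K·#touched}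
≤ e^{−Kt(Ψ0−Ψ1)} (B^{−κ₁} R^{KD})^{|A|} ≤ e^{−Kt(Ψ0−Ψ1)}` by `hcouple` — note `F_max/F₁ ≤ F_max/F_min = R`, so the
coupling hypothesis AS TYPED suffices. Size M (finite products over `Fin nv`/`Fin m`, the covariance and
monotonicity lemmas for `cxW`; the sibling's `cxWeight_eq_sum_inner` structure formula helps). -/
theorem stub_energy {lam qp qm : ℝ} (hlam : 0 < lam) (hqm : 0 < qm) (hlt : qm < qp) (hqp : qp < 1)
    {nv m D K κ₁ : ℕ} (E : Fin m → Fin 3 → Fin nv)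
    (hocc : ∀ x : Fin nv, (Finset.univ.filter fun p : Fin m × Fin 3 => E p.1 p.2 = x).card ≤ D)
    (b : Fin m → ZMod 2) (t : ℕ)
    (hfar : ∀ f : Fin nv → ZMod 2,
      t ≤ (Finset.univ.filter fun e : Fin m => ∑ i : Fin 3, f (E e i) ≠ b e).card)
    (hcouple : (K * D : ℝ) * Real.log (cxRho lam qp qm) ≤ κ₁ * Real.log (slyB qp qm))
    (Y : Fin nv × ZMod 2 → Bool) :
    lgW E lam qp qm κ₁ K b Y * Real.exp (K * t * (pwPsi lam qp qm 0 - pwPsi lam qp qm 1)) ≤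
      lgW E lam qp qm κ₁ K 0 lgRef := by
  sorry

/-- **S7 — the parameter regime is nonempty (asymptotic arithmetic at ONE gadget size).** For `θ > 0`, `d ≥ 3`,
constants `D`, `η, g, L_B > 0`, any `L_ρ` and any threshold `N₀` there are a gadget size `n ≥ N₀` and numbers
`K ≥ 1`, `κ₁` with: enough ports (`κ₁ + D·K ≤ slyM d θ n`), the sector inequality (`K·D·L_ρ ≤ κ₁·L_B`), small
gadget error (`n^{−2θ} ≤ 1/2`) and the per-variable budget `1 + 2 log(3n) ≤ K·η·g` (gain `K η g` per variable
beats phase entropy `2 log n` + sandwich loss `2 log 3` + the density `δ·N/nv ≤ 1`). Why true: take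
`K := ⌈(1 + 2 log 3n)/(ηg)⌉`, `κ₁ := ⌈K D max(L_ρ,0)/L_B⌉`, both `O(log n)`, while
`slyM d θ n = (d−1)^{⌊θ log_{d−1} n⌋} ≥ n^θ/(d−1)` and `log n = o(n^θ)` (`isLittleO_log_rpow_atTop`); it cannot
fail, but it is where the (astronomical, `(Δ,λ)`-dependent) constant gadget size is fixed — near `λ_c`, `g → 0`
and `n ≳ 10^{65}` at `(3, 4.2)` (triage r1-3). Size M (rpow/log/floor bookkeeping in the style of
`eventually_mul_rpow_rpow_le_slyB_pow`, `mul_slyK_le_slyM`). -/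
theorem stub_parameters {θ : ℝ} (hθ : 0 < θ) {d : ℕ} (hd : 3 ≤ d) (D : ℕ) {η g LB : ℝ} (hη : 0 < η)
    (hg : 0 < g) (hLB : 0 < LB) (Lρ : ℝ) (N₀ : ℕ) :
    ∃ n K κ₁ : ℕ, N₀ ≤ n ∧ 0 < n ∧ 1 ≤ K ∧
      Fintype.card (Fin κ₁ ⊕ (Fin D × Fin K)) ≤ slyM d θ n ∧
      (K * D : ℝ) * Lρ ≤ κ₁ * LB ∧
      (n : ℝ) ^ (-(2 * θ)) ≤ 1 / 2 ∧
      1 + 2 * Real.log (3 * n) ≤ K * η * g := by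
  sorry

/-! ## Proved glue -/

/-- The weights are nonnegative (`λ ≥ 0`, `q± ∈ [0, 1]`). -/
theorem lgW_nonneg (E : Fin m → Fin 3 → Fin nv) {lam qp qm : ℝ} (hlam : 0 ≤ lam) (hqm0 : 0 ≤ qm)
    (hqm1 : qm ≤ 1) (hqp0 : 0 ≤ qp) (hqp1 : qp ≤ 1) (κ₁ K : ℕ) (b : Fin m → ZMod 2)
    (Y : Fin nv × ZMod 2 → Bool) : 0 ≤ lgW E lam qp qm κ₁ K b Y := by
  have hocc : ∀ s, 0 ≤ occP qp qm s ∧ occP qp qm s ≤ 1 ∧ 0 ≤ occM qp qm s ∧ occM qp qm s ≤ 1 := by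
    intro s; cases s <;> simp [occP, occM] <;> refine ⟨?_, ?_, ?_, ?_⟩ <;> assumption
  unfold lgW
  refine mul_nonneg (Finset.prod_nonneg fun x _ => ?_) (Finset.prod_nonneg fun e _ => pow_nonneg ?_ _)
  · unfold pairW
    refine pow_nonneg (mul_nonneg ?_ ?_) _
    · obtain ⟨h1, h2, -, -⟩ := hocc (Y (x, 0))
      obtain ⟨h3, h4, -, -⟩ := hocc (Y (x, 1))
      nlinarith [mul_le_one₀ h2 h3 h4]
    · obtain ⟨-, -, h1, h2⟩ := hocc (Y (x, 0))
      obtain ⟨-, -, h3, h4⟩ := hocc (Y (x, 1))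
      nlinarith [mul_le_one₀ h2 h3 h4]
  · unfold cxW cxWeight
    refine div_nonneg (Finset.sum_nonneg fun J _ => ?_) (pow_nonneg (by linarith) _)
    split_ifs
    · refine mul_nonneg (pow_nonneg hlam _) (Finset.prod_nonneg fun p _ => ?_)
      split_ifs
      · obtain ⟨-, h2, -, -⟩ := hocc (Y (E e p.1, p.2))
        linarith
      · exact zero_le_one
    · exact le_rfl

/-- A labelling injective on the occurrences of each variable bounds the occurrence numbers by `D`. -/
theorem occ_le_of_loc (E : Fin m → Fin 3 → Fin nv) (loc : Fin m × Fin 3 → Fin D)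
    (hloc : ∀ p p' : Fin m × Fin 3, E p.1 p.2 = E p'.1 p'.2 → loc p = loc p' → p = p') (x : Fin nv) :
    (Finset.univ.filter fun p : Fin m × Fin 3 => E p.1 p.2 = x).card ≤ D := by
  have h := Finset.card_le_card_of_injOn loc
    (s := Finset.univ.filter fun p : Fin m × Fin 3 => E p.1 p.2 = x) (t := Finset.univ)
    (fun p _ => Finset.mem_univ _) (fun p hp p' hp' hpp => by
      have hp1 : E p.1 p.2 = x := (Finset.mem_filter.1 (Finset.mem_coe.1 hp)).2
      have hp2 : E p'.1 p'.2 = x := (Finset.mem_filter.1 (Finset.mem_coe.1 hp')).2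
      exact hloc p p' (hp1.trans hp2.symm) hpp)
  simpa using h

/-- **Sly's proof of Theorem 1 run for the two right-hand sides** (PROVED): from the two `LGCutEstimate`s
(error `δ ≤ 1/2`), the weight gap `lgW b Y · T ≤ lgW 0 ref` and `R · (3n)^{2nv} ≤ T`:
`R · Z(𝔊_b) ≤ Z(𝔊₀)`. Upper bound: `Z(𝔊_b) = Σ_Y Z_{𝔊_b}(Y) ≤ (1+δ)^{2nv} (W₀/T) Σ_Y Z_base(Y) =
(1+δ)^{2nv} (W₀/T) Z_base` — the sum over ALL phase vectors of the base weights is `Z_base`, so NO `4^{nv}`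
entropy term appears; lower bound: `Z(𝔊₀) ≥ Z_{𝔊₀}(ref) ≥ (1−δ)^{2nv} W₀ n^{−2nv} Z_base`; and
`(1+δ) ≤ 3(1−δ)`. -/
theorem twins_of_estimates (E : Fin m → Fin 3 → Fin nv) (loc : Fin m × Fin 3 → Fin D)
    (W : LWiring v P κ₁ D K) {lam qp qm δ : ℝ} (hlam : 0 ≤ lam) (hδ0 : 0 ≤ δ) (hδ : δ ≤ 1 / 2)
    {n : ℕ} (hn : 0 < n) (b : Fin m → ZMod 2) (hWnn : ∀ Y, 0 ≤ lgW E lam qp qm κ₁ K b Y)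
    (h0 : LGCutEstimate E loc W lam qp qm δ n 0) (hb : LGCutEstimate E loc W lam qp qm δ n b)
    {T R : ℝ} (hT : 0 < T) (hR : 0 ≤ R)
    (hgap : ∀ Y, lgW E lam qp qm κ₁ K b Y * T ≤ lgW E lam qp qm κ₁ K 0 lgRef)
    (hRT : R * (3 * (n : ℝ)) ^ (2 * nv) ≤ T) :
    R * independencePolynomial (lgGraph E loc W b) lam ≤ independencePolynomial (lgGraph E loc W 0) lam := by
  set Zb : (Fin nv × ZMod 2 → Bool) → ℝ :=
    fun Y => hardcoreZOn (lgBase nv m W) lam (fun I => lgPhase W I = Y) with hZb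
  set W0 : ℝ := lgW E lam qp qm κ₁ K 0 lgRef with hW0
  set Wb : (Fin nv × ZMod 2 → Bool) → ℝ := lgW E lam qp qm κ₁ K b with hWb
  set Zbase : ℝ := independencePolynomial (lgBase nv m W) lam with hZbase
  have hnR : (0 : ℝ) < n := by exact_mod_cast hn
  have hZb0 : ∀ Y, 0 ≤ Zb Y := fun Y => hardcoreZOn_nonneg _ hlam _
  have hZbase0 : 0 ≤ Zbase := (independencePolynomial_pos _ hlam).le
  have hW00 : 0 ≤ W0 := by
    have h1 := hgap lgRef
    have h2 : 0 ≤ Wb lgRef * T := mul_nonneg (hWnn lgRef) hT.le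
    exact h2.trans h1
  -- upper bound for `b`
  have hup : independencePolynomial (lgGraph E loc W b) lam ≤ (1 + δ) ^ (2 * nv) * (W0 / T) * Zbase := by
    rw [hZbase, ← sum_hardcoreZOn_fiber (lgGraph E loc W b) lam (lgPhase W),
      ← sum_hardcoreZOn_fiber (lgBase nv m W) lam (lgPhase W), Finset.mul_sum]
    refine Finset.sum_le_sum fun Y _ => ?_
    have h1 := (hb Y).2.2
    have h2 : Wb Y ≤ W0 / T := by
      rw [le_div_iff₀ hT]; exact hgap Y
    have h1δ : 0 ≤ (1 + δ) ^ (2 * nv) := pow_nonneg (by linarith) _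
    calc hardcoreZOn (lgGraph E loc W b) lam (fun I => lgPhase W I = Y)
        ≤ (1 + δ) ^ (2 * nv) * (Wb Y * Zb Y) := h1
      _ ≤ (1 + δ) ^ (2 * nv) * (W0 / T * Zb Y) :=
          mul_le_mul_of_nonneg_left (mul_le_mul_of_nonneg_right h2 (hZb0 Y)) h1δ
      _ = (1 + δ) ^ (2 * nv) * (W0 / T) * Zb Y := by ring
  -- lower bound for `0`
  have hlo : (1 - δ) ^ (2 * nv) * W0 * (((n : ℝ) ^ (2 * nv))⁻¹ * Zbase) ≤
      independencePolynomial (lgGraph E loc W 0) lam := by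
    have h1 := (h0 lgRef).2.1
    have h2 := (h0 lgRef).1
    have h1δ : 0 ≤ (1 - δ) ^ (2 * nv) := pow_nonneg (by linarith) _
    calc (1 - δ) ^ (2 * nv) * W0 * (((n : ℝ) ^ (2 * nv))⁻¹ * Zbase)
        ≤ (1 - δ) ^ (2 * nv) * W0 * Zb lgRef := mul_le_mul_of_nonneg_left h2 (mul_nonneg h1δ hW00)
      _ = (1 - δ) ^ (2 * nv) * (W0 * Zb lgRef) := by ring
      _ ≤ hardcoreZOn (lgGraph E loc W 0) lam (fun I => lgPhase W I = lgRef) := h1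
      _ ≤ independencePolynomial (lgGraph E loc W 0) lam := hardcoreZOn_le_independencePolynomial _ hlam _
  -- combine
  have hpow3 : (1 + δ) ^ (2 * nv) ≤ (3 * (1 - δ)) ^ (2 * nv) :=
    pow_le_pow_left₀ (by linarith) (by linarith) _
  have hWT : 0 ≤ W0 / T := div_nonneg hW00 hT.le
  have hn2 : (0 : ℝ) < (n : ℝ) ^ (2 * nv) := pow_pos hnR _
  have hX : 0 ≤ (1 - δ) ^ (2 * nv) * W0 * (((n : ℝ) ^ (2 * nv))⁻¹ * Zbase) := by
    have h1δ : 0 ≤ (1 - δ) ^ (2 * nv) := pow_nonneg (by linarith) _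
    positivity
  calc R * independencePolynomial (lgGraph E loc W b) lam
      ≤ R * ((1 + δ) ^ (2 * nv) * (W0 / T) * Zbase) := mul_le_mul_of_nonneg_left hup hR
    _ ≤ R * ((3 * (1 - δ)) ^ (2 * nv) * (W0 / T) * Zbase) := by
        refine mul_le_mul_of_nonneg_left ?_ hR
        exact mul_le_mul_of_nonneg_right (mul_le_mul_of_nonneg_right hpow3 hWT) hZbase0
    _ = (R * (3 * (n : ℝ)) ^ (2 * nv) / T) *
          ((1 - δ) ^ (2 * nv) * W0 * (((n : ℝ) ^ (2 * nv))⁻¹ * Zbase)) := by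
        rw [mul_pow, mul_pow]
        field_simp
    _ ≤ 1 * ((1 - δ) ^ (2 * nv) * W0 * (((n : ℝ) ^ (2 * nv))⁻¹ * Zbase)) := by
        refine mul_le_mul_of_nonneg_right ?_ hX
        rwa [div_le_one hT]
    _ = (1 - δ) ^ (2 * nv) * W0 * (((n : ℝ) ^ (2 * nv))⁻¹ * Zbase) := one_mul _
    _ ≤ independencePolynomial (lgGraph E loc W 0) lam := hlo

/-- **The budget arithmetic** (PROVED): the per-variable budget `1 + 2 log(3n) ≤ K η g` of S7, with
`N = 2·nv·v + 10·m·K`, `nv ≤ m ≤ c·nv`, `η m ≤ t` and `δ = 1/(2v + 10cK + 1)`, gives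
`e^{δ N} (3n)^{2nv} ≤ e^{K t g}`. -/
theorem budget {n K nv m t c v N : ℕ} {η g : ℝ} (hn : 0 < n) (hη : 0 ≤ η) (hg : 0 ≤ g)
    (hbudget : 1 + 2 * Real.log (3 * n) ≤ K * η * g) (hnvm : nv ≤ m) (hmc : m ≤ c * nv)
    (htη : η * m ≤ t) (hN : N = 2 * nv * v + 10 * m * K) :
    Real.exp (1 / ((2 * v + 10 * c * K + 1 : ℕ) : ℝ) * N) * (3 * (n : ℝ)) ^ (2 * nv) ≤
      Real.exp (K * t * g) := by
  have hnR : (0 : ℝ) < n := by exact_mod_cast hn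
  have h3n : (0 : ℝ) < 3 * n := by positivity
  have hlog : 0 ≤ Real.log (3 * n) := by
    refine Real.log_nonneg ?_
    have : (1 : ℝ) ≤ n := by exact_mod_cast hn
    linarith
  have hQpos : (0 : ℝ) < ((2 * v + 10 * c * K + 1 : ℕ) : ℝ) := by positivity
  -- `δ N ≤ nv`
  have hN' : (N : ℝ) ≤ ((2 * v + 10 * c * K + 1 : ℕ) : ℝ) * nv := by
    have hmc' : (m : ℝ) ≤ c * nv := by exact_mod_cast hmc
    have hK0 : (0 : ℝ) ≤ K := Nat.cast_nonneg K
    have hnv0 : (0 : ℝ) ≤ nv := Nat.cast_nonneg nv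
    have hv0 : (0 : ℝ) ≤ v := Nat.cast_nonneg v
    have h1 : (10 : ℝ) * m * K ≤ 10 * (c * nv) * K := by nlinarith
    rw [hN]
    push_cast
    nlinarith
  have hδN : 1 / ((2 * v + 10 * c * K + 1 : ℕ) : ℝ) * N ≤ nv := by
    rw [one_div, inv_mul_le_iff₀ hQpos]
    exact hN'
  -- logarithmic form
  have hpow : (3 * (n : ℝ)) ^ (2 * nv) = Real.exp (2 * nv * Real.log (3 * n)) := by
    rw [show (2 * nv * Real.log (3 * n) : ℝ) = ((2 * nv : ℕ) : ℝ) * Real.log (3 * n) by push_cast; ring,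
      Real.exp_nat_mul, Real.exp_log h3n]
  rw [hpow, ← Real.exp_add, Real.exp_le_exp]
  have hKg : (0 : ℝ) ≤ K * g := mul_nonneg (Nat.cast_nonneg K) hg
  have hnvm' : (nv : ℝ) ≤ m := by exact_mod_cast hnvm
  calc 1 / ((2 * v + 10 * c * K + 1 : ℕ) : ℝ) * N + 2 * nv * Real.log (3 * n)
      ≤ nv * (1 + 2 * Real.log (3 * n)) := by linarith
    _ ≤ nv * (K * η * g) := mul_le_mul_of_nonneg_left hbudget (Nat.cast_nonneg nv)
    _ = K * g * (η * nv) := by ring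
    _ ≤ K * g * (η * m) := mul_le_mul_of_nonneg_left (mul_le_mul_of_nonneg_left hnvm' hη) hKg
    _ ≤ K * g * t := mul_le_mul_of_nonneg_left htη hKg
    _ = K * t * g := by ring

/-- The independence polynomial is invariant under transport along a bijection of the vertices. -/
theorem independencePolynomial_map_equiv {α β : Type*} [Fintype α] [DecidableEq α] [Fintype β]
    [DecidableEq β] (G : SimpleGraph α) (e : α ≃ β) (lam : ℝ) :
    independencePolynomial (G.map e.toEmbedding) lam = independencePolynomial G lam := by
  have hadj : ∀ a b : α, (G.map e.toEmbedding).Adj (e.toEmbedding a) (e.toEmbedding b) ↔ G.Adj a b :=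
    fun a b => SimpleGraph.map_adj_apply
  have hind : ∀ I : Finset α,
      (G.map e.toEmbedding).IsIndepSet (↑(I.map e.toEmbedding) : Set β) ↔ G.IsIndepSet (↑I : Set α) := by
    intro I
    constructor
    · intro h a ha b hb hab
      have hab' : e.toEmbedding a ≠ e.toEmbedding b := fun h' => hab (e.injective h')
      have := h (Finset.mem_coe.2 (Finset.mem_map_of_mem _ (Finset.mem_coe.1 ha)))
        (Finset.mem_coe.2 (Finset.mem_map_of_mem _ (Finset.mem_coe.1 hb))) hab'
      exact fun hG => this ((hadj a b).2 hG)
    · intro h x hx y hy hxy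
      obtain ⟨a, ha, rfl⟩ := Finset.mem_map.1 (Finset.mem_coe.1 hx)
      obtain ⟨b, hb, rfl⟩ := Finset.mem_map.1 (Finset.mem_coe.1 hy)
      exact fun hG => h (Finset.mem_coe.2 ha) (Finset.mem_coe.2 hb) (fun hab => hxy (by rw [hab]))
        ((hadj a b).1 hG)
  unfold independencePolynomial
  symm
  refine Fintype.sum_equiv (Equiv.finsetCongr e) _ _ fun I => ?_
  rw [Equiv.finsetCongr_apply, Finset.card_map]
  by_cases hI : G.IsIndepSet (↑I : Set α)
  · rw [if_pos hI, if_pos ((hind I).2 hI)]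
  · rw [if_neg hI, if_neg (fun h => hI ((hind I).1 h))]

/-- Transport of a degree bound along an isomorphism, for ANY decidability instances (the crux statement
carries the classical ones). -/
theorem maxDegree_le_of_iso {α β : Type*} [Fintype α] [Fintype β] {G : SimpleGraph α} {H : SimpleGraph β}
    {iG : DecidableRel G.Adj} {iH : DecidableRel H.Adj} (f : G ≃g H) {Δ : ℕ}
    (h : @SimpleGraph.maxDegree α G _ iG ≤ Δ) : @SimpleGraph.maxDegree β H _ iH ≤ Δ := by
  have := f.maxDegree_eq
  rw [← this]; exact h

/-- The route's inlined sum IS `independencePolynomial`, for ANY decidability instances. -/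
theorem indepSum_eq {α : Type*} [Fintype α] [DecidableEq α] (G : SimpleGraph α) {iG : DecidableRel G.Adj}
    {dI : ∀ I : Finset α, Decidable (G.IsIndepSet (↑I : Set α))} (lam : ℝ) :
    (∑ I : Finset α, @ite ℝ (G.IsIndepSet (↑I : Set α)) (dI I) (lam ^ I.card) 0) =
      @independencePolynomial α _ _ G iG ℝ _ lam := by
  unfold independencePolynomial
  exact Finset.sum_congr rfl fun I _ => by congr

/-! ## The composition (kernel-checked, no `sorry` of its own) -/

/-- **`MacroscopicTwinsAbove` from the seven stubs.** Given `Δ ≥ 3` and `λ > λ_c(Δ)`: S1 gives `d, θ, q±` and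
a gadget threshold; S6(i) gives `g = Ψ0 − Ψ1 > 0`; S2 gives the constants `D, c, η`; S7 fixes ONE gadget size `n`
with `K, κ₁` meeting the port budget, the sector inequality, `n^{−2θ} ≤ 1/2` and the per-variable budget; the
gadget at `n` and `δ := 1/(2v + 10cK + 1)` are fixed BEFORE `k`. For each `k`: S2 at `k+1` gives the far,
`(6(k+1),1)`-expanding system `(E, loc, b, t)`; the twins are `lgGraph E loc W 0`, `lgGraph E loc W b` transported
to `Fin N`, `N = 2·nv·v + 10·m·K`: degrees by S4; `≡_{C^{k+1}}` by S3 (p = q = 1, s = 6(k+1), K₀ = 3(k+1)) and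
`CkEquiv.iso_congr`, turned into the hom-count clause for treewidth `< k` by the PROVED Dvořák bridge; the gap
`e^{δN}` by S5 (twice), S6(ii), `budget` and `twins_of_estimates`. -/
theorem MacroscopicTwinsAbove_of : MacroscopicTwinsAbove := by
  intro Δ hΔ lam hlam
  have hlam' : hardCoreThreshold Δ < lam := hlam
  obtain ⟨d, hd3, hdΔ, hdlam, θ, qp, qm, hθ, hθ8, hqm, hlt, hqp, nA, hnA⟩ := stub_slyGadgets Δ hΔ lam hlam'
  have hlam0 : 0 < lam := (hardCoreThreshold_pos hd3).trans hdlam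
  -- the energy landscape: contrast `g > 0` and the sector optimisation
  have hvis : pwPsi lam qp qm 1 < pwPsi lam qp qm 0 := stub_chargeVisible hlam0 hqm hlt hqp
  have hg : 0 < pwPsi lam qp qm 0 - pwPsi lam qp qm 1 := sub_pos.2 hvis
  have hLB : 0 < Real.log (slyB qp qm) := Real.log_pos (one_lt_slyB hqm hlt hqp)
  -- the constants of the base systems
  obtain ⟨D, c, η, hη, hsys⟩ := stub_farSystems
  -- ONE gadget size `n` and the numbers `K, κ₁`
  obtain ⟨n, K, κ₁, hnA', hn, hK1, hslots, hcouple, hδhalf, hbud⟩ :=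
    stub_parameters hθ hd3 D hη hg hLB (Real.log (cxRho lam qp qm)) nA
  obtain ⟨v, G, Wp, Wm, Vp, Vm, hv, hdeg, -, hVV, hdp, hdm, hA, hB⟩ := hnA n hnA'
  let W : LWiring v (slyM d θ n) κ₁ D K := ⟨G, Wp, Wm, Vp, Vm, slotEmb hslots⟩
  have hnR : (0 : ℝ) < n := by exact_mod_cast hn
  have hδ0 : 0 ≤ (n : ℝ) ^ (-(2 * θ)) := Real.rpow_nonneg hnR.le _
  -- the density constant, fixed before `k`
  refine ⟨1 / ((2 * v + 10 * c * K + 1 : ℕ) : ℝ), by positivity, fun k => ?_⟩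
  -- the base system at `k + 1`
  obtain ⟨nv, m, t, E, loc, b, hnv, hnvm, hmc, hE, hloc, hexp, htη, hfar⟩ := hsys (12 * (k + 1))
  let X : SimpleGraph (LGVert nv m v K) := lgGraph E loc W 0
  let X' : SimpleGraph (LGVert nv m v K) := lgGraph E loc W b
  let N : ℕ := Fintype.card (LGVert nv m v K)
  have hNcard : N = 2 * nv * v + 10 * m * K := card_LGVert nv m v K
  let e : LGVert nv m v K ≃ Fin N := Fintype.equivFin (LGVert nv m v K)
  -- the estimates
  have hcut0 : LGCutEstimate E loc W lam qp qm ((n : ℝ) ^ (-(2 * θ))) n 0 :=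
    stub_connector E loc hloc W hlam0.le hqm hlt hqp hδ0 (hδhalf.trans (by norm_num)) hn hVV hA hB 0
  have hcutb : LGCutEstimate E loc W lam qp qm ((n : ℝ) ^ (-(2 * θ))) n b :=
    stub_connector E loc hloc W hlam0.le hqm hlt hqp hδ0 (hδhalf.trans (by norm_num)) hn hVV hA hB b
  have hgap : ∀ Y : Fin nv × ZMod 2 → Bool,
      lgW E lam qp qm κ₁ K b Y * Real.exp (K * t * (pwPsi lam qp qm 0 - pwPsi lam qp qm 1)) ≤
        lgW E lam qp qm κ₁ K 0 lgRef :=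
    fun Y => stub_energy hlam0 hqm hlt hqp E (occ_le_of_loc E loc hloc) b t hfar hcouple Y
  have hRT := budget (v := v) (N := N) hn hη.le hg.le hbud hnvm hmc htη hNcard
  have htwins : Real.exp (1 / ((2 * v + 10 * c * K + 1 : ℕ) : ℝ) * N) * independencePolynomial X' lam ≤
      independencePolynomial X lam :=
    twins_of_estimates E loc W hlam0.le hδ0 hδhalf hn b
      (fun Y => lgW_nonneg E hlam0.le hqm.le (hlt.le.trans hqp.le) (hqm.le.trans hlt.le) hqp.le κ₁ K b Y)
      hcut0 hcutb (Real.exp_pos _) (Real.exp_pos _).le hgap hRT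
  -- Duplicator at depth `k + 1`
  have hck : CkEquiv (k + 1) X X' :=
    stub_duplicator E hE loc W b (s := 12 * (k + 1)) (p := 2) (q := 1) (K₀ := 3 * (k + 1)) (by omega)
      one_pos (fun T hT => by rw [one_mul]; exact hexp T hT) (by omega) le_rfl
  have hdegX : X.maxDegree ≤ Δ := stub_maxDegree E loc hloc W 0 hΔ hdΔ hdeg hVV hdp hdm
  have hdegX' : X'.maxDegree ≤ Δ := stub_maxDegree E loc hloc W b hΔ hdΔ hdeg hVV hdp hdm
  refine ⟨N, X.map e.toEmbedding, X'.map e.toEmbedding, ?_, ?_, ?_, ?_, ?_⟩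
  · -- `0 < N`
    rw [hNcard]
    have h1 : 1 ≤ m := hnv.trans_le hnvm
    have h2 : 10 * 1 * 1 ≤ 10 * m * K := Nat.mul_le_mul (Nat.mul_le_mul_left 10 h1) hK1
    omega
  · -- maximum degree of the first twin
    exact maxDegree_le_of_iso (SimpleGraph.Iso.map e X) hdegX
  · -- maximum degree of the second twin
    exact maxDegree_le_of_iso (SimpleGraph.Iso.map e X') hdegX'
  · -- homomorphism indistinguishability below treewidth `k < k + 1`
    intro mF F hF
    have hck' : CkEquiv (k + 1) (X.map e.toEmbedding) (X'.map e.toEmbedding) :=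
      hck.iso_congr (SimpleGraph.Iso.map e X) (SimpleGraph.Iso.map e X')
    exact Literature.ModelTheory.FiniteModelTheory.Dvorak2010.homCount_eq_of_ckEquiv (by omega) hck' F
      (Nat.lt_succ_of_lt hF)
  · -- the macroscopic gap, transported to `Fin N`
    have hZ := htwins
    rw [← independencePolynomial_map_equiv X e lam, ← independencePolynomial_map_equiv X' e lam] at hZ
    convert hZ using 2 <;> exact indepSum_eq _ _

end Summit.PneNP.PneNP.Cruxes.MacroscopicTwinsAbove.LiteralGadgetsCfiApparatus
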